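import Literature.MathematicalPhysics.QuantumLattice.HubbardChainEnergyDensityAt
import Literature.MathematicalPhysics.QuantumLattice.HubbardChainSegmentUpperBound
import Literature.MathematicalPhysics.QuantumLattice.GroundEnergyDensityMatrixBound
import HarnessLib

/-!
# Segment (open-chain) upper bounds for the Hubbard chain at general filling, in the thermodynamic limit

Family `hubbard` (trunk T-QLATTICE). The doped companion of `HubbardChainSegmentUpperBound`
(half filling): the ring-limit energy density at `p` electrons per `q` sites,
`e(p/q) = ThermodynamicLimit.hubbardChainEnergyDensityAt t U p q = lim_m E₀(ring qm, N = pm)/(qm)`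
(`HubbardChainEnergyDensityAt`), is bounded above by the ground energy — or the energy of ANY trial
state, pure or mixed — of an OPEN segment of `a` sites carrying `N₀` electrons at the same filling
`N₀/a = p/q`:

* `hubbardChainEnergyDensityAt_le_segment` — `e(p/q) ≤ E₀(path a, N₀)/a` (`N₀·q = p·a`, `a ≥ 1`, `U ≥ 0`);
* `hubbardChainEnergyDensityAt_le_re_expect_segment` — `e(p/q) ≤ Re⟨ψ, H_{path a} ψ⟩/a` for every unit
  `N₀`-particle vector `ψ` of the segment (segment-product / matrix-product trial states);
* `hubbardChainEnergyDensityAt_le_mixture_segment` — the same for a finite mixture `Σᵢ wᵢ |ψᵢ⟩⟨ψᵢ|` of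
  unit `N₀`-particle vectors (mixed segment states, e.g. reduced states of a translation-invariant
  matrix-product state).
* `hubbardChainEnergyDensityAt_le_re_trace_segment`, `hubbardChainEnergyDensity_le_re_trace_segment` —
  the same for an arbitrary DENSITY MATRIX `ρ ⪰ 0`, `Tr ρ = 1`, supported in the `N₀`-particle sector of
  the segment: `e ≤ Re Tr(ρ H_{path a})/a` (via the mixed-state variational principle
  `groundEnergy_le_re_trace_mul`, `GroundEnergyDensityMatrixBound`).

The finite-volume input is the tree's filling-general ring-versus-segments inequality
`groundEnergyAt_ring_le_mul_segment` (`E₀(ring a·m, N₀·m) ≤ m·E₀(path a, N₀)`: close the open chain into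
the ring — the extra bond costs nothing between particle-number eigenstates — and cut it into segments);
the limit is read along the rings `q·(a·j)`. No boundary `8|t|/L` term appears (contrast
`hubbardChainEnergyDensityAt_le_of_le`, one ring). Everything is proved; no named fact is introduced.

## References
* D. Ruelle, *Statistical Mechanics: Rigorous Results* (1969), §2.2 (existence of the thermodynamic
  limit by subadditivity; the limit is the infimum over boxes). [cite: Ruelle1969, §2.2]
* E. H. Lieb, F. Y. Wu, Phys. Rev. Lett. 20 (1968) 1445 (the chain at arbitrary filling).
  [cite: LiebWuPRL1968, eq. (20)]
-/

noncomputable section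

open Filter Topology Matrix Finset
open scoped BigOperators ComplexOrder

namespace Literature.MathematicalPhysics.QuantumLattice

namespace ThermodynamicLimit

/-- Transport of `groundEnergyAt` along an equality of ring lengths (the vertex type depends on `L`).
[cite: Ruelle1969, §2.2] -/
private theorem groundEnergyAt_ring_congr (t U : ℝ) {L₁ L₂ : ℕ} (h : L₁ = L₂) (N : ℕ) :
    groundEnergyAt (fermionTorusGraph 1 L₁) t U N = groundEnergyAt (fermionTorusGraph 1 L₂) t U N := by
  subst h
  rfl

/-- **Thermodynamic limit at filling `p/q`, segment ground energies**: for `U ≥ 0`, `1 ≤ q`, `p ≤ 2q`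
and every open segment of `a ≥ 1` sites with `N₀` electrons at the same filling (`N₀·q = p·a`),
`e(p/q) ≤ E₀(path a, N₀)/a`. Proof: along the rings `L = q·(a·j)` (`j ≥ 2`) the ring energy with
`p·(a·j) = N₀·(q·j)` electrons is at most `(q·j)·E₀(path a, N₀)` (`groundEnergyAt_ring_le_mul_segment`),
and `E₀(L, pL/q)/L → e(p/q)` (`tendsto_hubbardChainEnergyDensityAt`). Ruelle (1969) §2.2 (the limit is
the infimum over boxes). [cite: Ruelle1969, §2.2] -/
theorem hubbardChainEnergyDensityAt_le_segment (t : ℝ) {U : ℝ} (hU : 0 ≤ U) {p q : ℕ} (hq : 1 ≤ q)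
    (hp : p ≤ 2 * q) {a N₀ : ℕ} (ha : 1 ≤ a) (hfill : N₀ * q = p * a) :
    hubbardChainEnergyDensityAt t U p q ≤ groundEnergyAt (SimpleGraph.pathGraph a) t U N₀ / a := by
  have hN₀ : N₀ ≤ 2 * a := by nlinarith
  set js : ℕ → ℕ := fun j => a * (j + 2) with hjs
  have hjs_tendsto : Tendsto js atTop atTop := by
    refine tendsto_atTop_mono (fun j => ?_) tendsto_id
    show j ≤ a * (j + 2)
    nlinarith
  have hlim := (tendsto_hubbardChainEnergyDensityAt t hU hq hp).comp hjs_tendsto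
  refine le_of_tendsto' hlim fun j => ?_
  have haR : (0 : ℝ) < a := by exact_mod_cast ha
  have hm2 : 2 ≤ q * (j + 2) := le_trans (by omega) (Nat.mul_le_mul_right (j + 2) hq)
  have hLpos : (0 : ℝ) < ((q * (a * (j + 2)) : ℕ) : ℝ) := by positivity
  have h := groundEnergyAt_ring_le_mul_segment a (q * (j + 2)) ha hm2 t U hN₀
  have hL : a * (q * (j + 2)) = q * (a * (j + 2)) := by ring
  have hN : N₀ * (q * (j + 2)) = p * (a * (j + 2)) := by
    calc N₀ * (q * (j + 2)) = N₀ * q * (j + 2) := by ring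
      _ = p * a * (j + 2) := by rw [hfill]
      _ = p * (a * (j + 2)) := by ring
  rw [groundEnergyAt_ring_congr t U hL, hN] at h
  rw [Function.comp_apply, hjs]
  dsimp only
  rw [div_le_div_iff₀ hLpos haR]
  calc groundEnergyAt (fermionTorusGraph 1 (q * (a * (j + 2)))) t U (p * (a * (j + 2))) * a
      ≤ ((q * (j + 2) : ℕ) : ℝ) * groundEnergyAt (SimpleGraph.pathGraph a) t U N₀ * a :=
        mul_le_mul_of_nonneg_right h haR.le
    _ = groundEnergyAt (SimpleGraph.pathGraph a) t U N₀ * ((q * (a * (j + 2)) : ℕ) : ℝ) := by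
        push_cast
        ring

/-- **Thermodynamic limit at filling `p/q`, segment trial states**: `e(p/q) ≤ Re⟨ψ, H_{path a} ψ⟩/a`
for every unit `N₀`-particle vector `ψ` of the open segment of `a ≥ 1` sites, `N₀·q = p·a` (`U ≥ 0`).
The thermodynamic-limit form of segment-product / matrix-product upper-bound certificates at general
filling (at `p = q = 1`, `N₀ = a` this is `hubbardChainEnergyDensity_le_re_expect_segment`, by
`hubbardChainEnergyDensityAt_one_one`). [cite: Ruelle1969, §2.2] -/
theorem hubbardChainEnergyDensityAt_le_re_expect_segment (t : ℝ) {U : ℝ} (hU : 0 ≤ U) {p q : ℕ}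
    (hq : 1 ≤ q) (hp : p ≤ 2 * q) {a N₀ : ℕ} (ha : 1 ≤ a) (hfill : N₀ * q = p * a)
    (ψ : Fock (Orb (Fin a))) (hψN : IsNParticle N₀ ψ) (hψ1 : star ψ ⬝ᵥ ψ = 1) :
    hubbardChainEnergyDensityAt t U p q ≤
      (star ψ ⬝ᵥ (hamiltonian (SimpleGraph.pathGraph a) t U *ᵥ ψ)).re / a := by
  have h1 := hubbardChainEnergyDensityAt_le_segment t hU hq hp ha hfill
  have h2 : groundEnergyAt (SimpleGraph.pathGraph a) t U N₀ ≤
      (star ψ ⬝ᵥ (hamiltonian (SimpleGraph.pathGraph a) t U *ᵥ ψ)).re :=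
    groundEnergy_le_re_expect _ hψN hψ1
  have haR : (0 : ℝ) < a := by exact_mod_cast ha
  exact h1.trans (div_le_div_of_nonneg_right h2 haR.le)

/-- **Mixed segment states**: for a finite mixture of unit `N₀`-particle vectors `ψᵢ` of the open
segment of `a ≥ 1` sites with weights `wᵢ ≥ 0`, `Σᵢ wᵢ = 1` (`N₀·q = p·a`, `U ≥ 0`),
`e(p/q) ≤ (Σᵢ wᵢ Re⟨ψᵢ, H_{path a} ψᵢ⟩)/a` — the energy per site of the density matrix `Σᵢ wᵢ |ψᵢ⟩⟨ψᵢ|`.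
(Any density matrix supported in the `N₀`-particle sector is such a mixture, by its spectral
decomposition.) [cite: Ruelle1969, §2.2] -/
theorem hubbardChainEnergyDensityAt_le_mixture_segment (t : ℝ) {U : ℝ} (hU : 0 ≤ U) {p q : ℕ}
    (hq : 1 ≤ q) (hp : p ≤ 2 * q) {a N₀ : ℕ} (ha : 1 ≤ a) (hfill : N₀ * q = p * a)
    {ι : Type*} (s : Finset ι) (w : ι → ℝ) (hw : ∀ i ∈ s, 0 ≤ w i) (hw1 : ∑ i ∈ s, w i = 1)
    (ψ : ι → Fock (Orb (Fin a))) (hψN : ∀ i ∈ s, IsNParticle N₀ (ψ i))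
    (hψ1 : ∀ i ∈ s, star (ψ i) ⬝ᵥ ψ i = 1) :
    hubbardChainEnergyDensityAt t U p q ≤
      (∑ i ∈ s, w i * (star (ψ i) ⬝ᵥ (hamiltonian (SimpleGraph.pathGraph a) t U *ᵥ ψ i)).re) / a := by
  have haR : (0 : ℝ) < a := by exact_mod_cast ha
  have hi : ∀ i ∈ s, w i * (hubbardChainEnergyDensityAt t U p q * a) ≤
      w i * (star (ψ i) ⬝ᵥ (hamiltonian (SimpleGraph.pathGraph a) t U *ᵥ ψ i)).re := by
    intro i hi
    refine mul_le_mul_of_nonneg_left ?_ (hw i hi)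
    have h := hubbardChainEnergyDensityAt_le_re_expect_segment t hU hq hp ha hfill (ψ i) (hψN i hi)
      (hψ1 i hi)
    rwa [le_div_iff₀ haR] at h
  have hsum := Finset.sum_le_sum hi
  rw [← Finset.sum_mul, hw1, one_mul] at hsum
  rwa [le_div_iff₀ haR]

/-- **Half filling as the special case `p = q = 1`** (consistency with `HubbardChainSegmentUpperBound`):
`e(1/1) ≤ E₀(path a, a)/a` is `hubbardChainEnergyDensity_le_segment`. [cite: Ruelle1969, §2.2] -/
theorem hubbardChainEnergyDensityAt_one_one_le_segment (t : ℝ) {U : ℝ} (hU : 0 ≤ U) {a : ℕ}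
    (ha : 1 ≤ a) :
    hubbardChainEnergyDensityAt t U 1 1 ≤ groundEnergyAt (SimpleGraph.pathGraph a) t U a / a := by
  rw [hubbardChainEnergyDensityAt_one_one t hU]
  exact hubbardChainEnergyDensity_le_segment t hU ha

/-- **Density-matrix segment states, general filling**: for `ρ ⪰ 0` on the Fock space of the open
segment of `a ≥ 1` sites, supported in the `N₀`-particle sector (`ρ s t = 0` unless `|t| = N₀`) and of
trace one, `e(p/q) ≤ Re Tr(ρ H_{path a})/a` (`N₀·q = p·a`, `U ≥ 0`). This is the input shape of
transfer-operator / finitely-correlated (uniform matrix-product) upper bounds, whose reduced segment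
states are mixed. [cite: Ruelle1969, §2.2] [cite: Tasaki2020, §2.1] -/
theorem hubbardChainEnergyDensityAt_le_re_trace_segment (t : ℝ) {U : ℝ} (hU : 0 ≤ U) {p q : ℕ}
    (hq : 1 ≤ q) (hp : p ≤ 2 * q) {a N₀ : ℕ} (ha : 1 ≤ a) (hfill : N₀ * q = p * a)
    {ρ : Matrix (Finset (Orb (Fin a))) (Finset (Orb (Fin a))) ℂ} (hρ : ρ.PosSemidef)
    (hsupp : ∀ s s' : Finset (Orb (Fin a)), s'.card ≠ N₀ → ρ s s' = 0) (htr : ρ.trace = 1) :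
    hubbardChainEnergyDensityAt t U p q ≤
      (ρ * hamiltonian (SimpleGraph.pathGraph a) t U).trace.re / a := by
  have h1 := hubbardChainEnergyDensityAt_le_segment t hU hq hp ha hfill
  have h2 : groundEnergyAt (SimpleGraph.pathGraph a) t U N₀ ≤
      (ρ * hamiltonian (SimpleGraph.pathGraph a) t U).trace.re :=
    groundEnergy_le_re_trace_mul _ hρ hsupp htr
  have haR : (0 : ℝ) < a := by exact_mod_cast ha
  exact h1.trans (div_le_div_of_nonneg_right h2 haR.le)

/-- **Density-matrix segment states, half filling**: `e(t,U) ≤ Re Tr(ρ H_{path a})/a` for every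
density matrix `ρ` of the open segment of `a ≥ 1` sites supported in the `a`-particle sector
(`hubbardChainEnergyDensity`, the `N = L` ring limit). [cite: Ruelle1969, §2.2] [cite: Tasaki2020, §2.1] -/
theorem hubbardChainEnergyDensity_le_re_trace_segment (t : ℝ) {U : ℝ} (hU : 0 ≤ U) {a : ℕ}
    (ha : 1 ≤ a) {ρ : Matrix (Finset (Orb (Fin a))) (Finset (Orb (Fin a))) ℂ} (hρ : ρ.PosSemidef)
    (hsupp : ∀ s s' : Finset (Orb (Fin a)), s'.card ≠ a → ρ s s' = 0) (htr : ρ.trace = 1) :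
    hubbardChainEnergyDensity t U ≤ (ρ * hamiltonian (SimpleGraph.pathGraph a) t U).trace.re / a := by
  rw [← hubbardChainEnergyDensityAt_one_one t hU]
  exact hubbardChainEnergyDensityAt_le_re_trace_segment t hU le_rfl (by norm_num) ha (by ring) hρ
    hsupp htr

end ThermodynamicLimit

end Literature.MathematicalPhysics.QuantumLattice

end
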